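import Summits.CriticalPhenomena.PercolationContinuityZ3.Theorems.PercNearOneGluingNoHeavyQuantBlockCombTwoPlateauRoot
import HarnessLib

/-!
# QUANT lane R8, FAR on trees: the LIGHT-MERGE row (`D = 1`) — a block-star whose unreliable blobs can see `j` reliable relays
# (canonical block-comb model)

builds on p205010 (kernel theorem, internal audit signed; external expert review pending)

Support file (`--supports stmt-CriticalPhenomena-4575`), QUANT lane seat prim-quant-p1 (gen 9); memo
`run/shared/lean/prim/quant/P1-SURPLUS.md` §20.  Theorems only (local notation, no definitions), no sorries, standard axioms.
Model and notation: `…QuantBlockCombMergeModel.lean` (chain gates `q`, levels `lv`, sizes `a`, private gates `g`, explicit tail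
`TAIL = P(N ≥ j+1)`; the marginal of blob `k` is `(∏_{i<lv k} q i)·g k`); tools: the law-free merge step `Quant.BlockComb.tail_transfer_le`
(p242084), the block-star row under the mean hypothesis `Quant.BlockComb.tail_one_ge_rootGate_of_mean` (lead g13, p245022) and the
affine-in-one-gate identity `Quant.BlockComb.sum_wt_update_eq` (lead g12).  Companion (every depth, corollaries):
`…QuantBlockCombLightRoots.lean`.

Call a root blob LIGHT when its private gate is below the chain gate `t = q 0` and RELIABLE otherwise (`g k ≥ t`; the sure level-`1` blobs
are reliable).

* `Quant.BlockComb.tail_update_dead` — the tail does not depend on the gate of a dead blob (`a s = 0`).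
* `Quant.BlockComb.sum_cast_transfer_mul` — bookkeeping: a transfer `s → ℓ` changes `Σ_k a k·c k` by `a s·(c ℓ − c s)`.
* `Quant.BlockComb.tail_one_ge_rootGate_of_lightMerge` — **THE LIGHT-MERGE ROW, `D = 1`.**  One chain gate `t = q 0`, root blobs with
  ARBITRARY private gates, level-`1` blobs sure, a layer `j ≥ 1`, the MEAN hypothesis `2j < Σ_{lv k = 0} a k·g k + t·Σ_{lv k ≠ 0} a k`, and
  the MERGE hypothesis: every live light blob `s` satisfies `j ≤ g s·(reliable mass)`.  Then `t ≤ TAIL[1] = P(N ≥ j+1)`.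
  PROOF (induction on the number of light blobs): the least reliable live light blob `s` satisfies the hypothesis `j ≤ g s·Σ_{k≠s} a k` of
  the merge step, so it moves into SOME other live blob `ℓ` without raising the tail; `g ℓ ≥ g s` (either `ℓ` is light — and `s` was the
  least reliable light blob — or `ℓ` is reliable), so the mean does not decrease (a move into a sure level-`1` blob trades `a s·g s` for
  `t·a s`); the reliable mass does not decrease and the gates of the remaining light blobs are unchanged, so the merge hypothesis persists;
  the dead source's gate is irrelevant (`tail_update_dead`) and is reset to `1`.  With no light blob left every root gate is `≥ t` and
  `tail_one_ge_rootGate_of_mean` (FAR for independent blobs, lead g5) concludes.  No hypothesis on the root mass is needed: light blobs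
  merge into RELIABLE mass under the weak budget (contrast: in the strong regime / the class `(Σ a)·x > 2j`, p242699/p243788, light blobs
  merge into each other under `A·g > 2j`).
Honest scope: a light blob that cannot see `j` reliable relays (`g s·(reliable mass) < j`: LEAD-NOTES-G13 N24 (4)'s harmonic staircase,
P1-SURPLUS §19.9 (b)) is NOT covered — there the row needs an anti-concentration input, not a merge.  The statement is false at `j = 0`
(a lone light blob of gate `g < t` has `P(N ≥ 1) = g`).
-/

namespace Summit.CriticalPhenomena.PercolationContinuityZ3.Theorems

namespace Quant

namespace BlockComb

open Finset

variable {κ : Type*} [Fintype κ] [DecidableEq κ]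

/-- product-Bernoulli weight of the set `S` of open blob gates -/
local notation3 "wt[" g ", " S "]" => ∏ k, (if k ∈ (S : Finset κ) then (g : κ → ℝ) k else 1 - (g : κ → ℝ) k)

/-- the same weight with the gate of `s` removed -/
local notation3 "wt'[" g ", " s ", " S "]" =>
  ∏ k ∈ (Finset.univ : Finset κ).erase s, (if k ∈ (S : Finset κ) then (g : κ → ℝ) k else 1 - (g : κ → ℝ) k)

/-- probability that the chain `q` of length `D` is open exactly to depth `i` -/
local notation3 "pd[" D ", " q ", " i "]" =>
  (∏ i' ∈ Finset.range (i : ℕ), (q : ℕ → ℝ) i') * (if (i : ℕ) < (D : ℕ) then 1 - (q : ℕ → ℝ) i else 1)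

/-- mass counted at depth `i` in blob configuration `S` -/
local notation3 "mass[" lv ", " a ", " i ", " S "]" =>
  ∑ k ∈ (S : Finset κ).filter (fun k => (lv : κ → ℕ) k ≤ (i : ℕ)), ((a : κ → ℕ) k : ℕ)

/-- the tail `P(N ≥ j+1)` of the block-comb count, as an explicit finite sum -/
local notation3 "TAIL[" D ", " q ", " lv ", " a ", " g ", " j "]" =>
  ∑ i ∈ Finset.range ((D : ℕ) + 1), pd[D, q, i] *
    ∑ S : Finset κ, wt[g, S] * (if (j : ℕ) + 1 ≤ mass[lv, a, i, S] then (1 : ℝ) else 0)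

/-! ### 1. Bookkeeping: dead gates, transfers, prefix products -/

omit [Fintype κ] in
/-- Inserting a dead blob (`a s = 0`) into a configuration does not change the counted mass. [folklore] -/
theorem mass_insert_dead (lv : κ → ℕ) (a : κ → ℕ) (s : κ) (i : ℕ) (S : Finset κ) (hs : a s = 0) :
    mass[lv, a, i, insert s S] = mass[lv, a, i, S] := by
  by_cases hsS : s ∈ S
  · rw [Finset.insert_eq_of_mem hsS]
  · rw [Finset.filter_insert]
    by_cases hlv : lv s ≤ i
    · rw [if_pos hlv]
      have hs' : s ∉ S.filter (fun k => lv k ≤ i) := fun h => hsS (Finset.mem_filter.1 h).1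
      show (∑ k ∈ insert s (S.filter (fun k => lv k ≤ i)), a k) = ∑ k ∈ S.filter (fun k => lv k ≤ i), a k
      rw [Finset.sum_insert hs', hs, zero_add]
    · rw [if_neg hlv]

/-- **The tail does not depend on the gate of a dead blob**: if `a s = 0` then replacing `g s` by any `t` leaves `TAIL` unchanged
(the configuration sum is affine in `g s`, `sum_wt_update_eq`, with slope `Σ_{S ∌ s} wt₋ₛ S·(F (insert s S) − F S) = 0`). [folklore] -/
theorem tail_update_dead (D : ℕ) (q : ℕ → ℝ) (lv : κ → ℕ) (a : κ → ℕ) (g : κ → ℝ) (j : ℕ) (s : κ) (t : ℝ)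
    (hs : a s = 0) :
    TAIL[D, q, lv, a, Function.update g s t, j] = TAIL[D, q, lv, a, g, j] := by
  refine Finset.sum_congr rfl fun i _ => ?_
  congr 1
  rw [sum_wt_update_eq g s t]
  have hzero : ∑ S : Finset κ, (if s ∈ S then 0 else wt'[g, s, S] *
      ((if j + 1 ≤ mass[lv, a, i, insert s S] then (1 : ℝ) else 0) -
        (if j + 1 ≤ mass[lv, a, i, S] then (1 : ℝ) else 0))) = 0 := by
    refine Finset.sum_eq_zero fun S _ => ?_
    by_cases h : s ∈ S
    · rw [if_pos h]
    · rw [if_neg h, mass_insert_dead lv a s i S hs, sub_self, mul_zero]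
  rw [hzero, mul_zero, add_zero]

/-- **Transfer bookkeeping.**  Moving the `a s` relays of blob `s` onto blob `ℓ ≠ s` (sizes `a ↦ a[s ↦ 0][ℓ ↦ a ℓ + a s]`) changes a
weighted size sum `Σ_k a k·c k` by `a s·(c ℓ − c s)`. [folklore] -/
theorem sum_cast_transfer_mul (a : κ → ℕ) (s ℓ : κ) (hℓs : ℓ ≠ s) (c : κ → ℝ) :
    ∑ k, ((Function.update (Function.update a s 0) ℓ (Function.update a s 0 ℓ + a s) k : ℕ) : ℝ) * c k =
      ∑ k, (a k : ℝ) * c k + (a s : ℝ) * (c ℓ - c s) := by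
  set a₀ := Function.update a s 0 with ha₀
  set aT := Function.update a₀ ℓ (a₀ ℓ + a s) with haT
  have ha₀s : a₀ s = 0 := by rw [ha₀, Function.update_self]
  have ha₀ne : ∀ k, k ≠ s → a₀ k = a k := fun k hk => by rw [ha₀, Function.update_of_ne hk]
  have haTℓ : aT ℓ = a ℓ + a s := by rw [haT, Function.update_self, ha₀ne ℓ hℓs]
  have haTne : ∀ k, k ≠ ℓ → aT k = a₀ k := fun k hk => by rw [haT, Function.update_of_ne hk]
  -- split both sums at `ℓ` and then at `s`
  have hsℓ : s ∈ (Finset.univ : Finset κ) \ {ℓ} := by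
    rw [Finset.mem_sdiff, Finset.mem_singleton]; exact ⟨Finset.mem_univ _, hℓs.symm⟩
  have hL := Finset.sum_eq_add_sum_sdiff_singleton_of_mem (Finset.mem_univ ℓ) (fun k => ((aT k : ℕ) : ℝ) * c k)
  have hL' := Finset.sum_eq_add_sum_sdiff_singleton_of_mem hsℓ (fun k => ((aT k : ℕ) : ℝ) * c k)
  have hR := Finset.sum_eq_add_sum_sdiff_singleton_of_mem (Finset.mem_univ ℓ) (fun k => (a k : ℝ) * c k)
  have hR' := Finset.sum_eq_add_sum_sdiff_singleton_of_mem hsℓ (fun k => (a k : ℝ) * c k)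
  have hrest : ∑ k ∈ ((Finset.univ : Finset κ) \ {ℓ}) \ {s}, ((aT k : ℕ) : ℝ) * c k =
      ∑ k ∈ ((Finset.univ : Finset κ) \ {ℓ}) \ {s}, (a k : ℝ) * c k := by
    refine Finset.sum_congr rfl fun k hk => ?_
    rw [Finset.mem_sdiff, Finset.mem_sdiff, Finset.mem_singleton, Finset.mem_singleton] at hk
    rw [haTne k hk.1.2, ha₀ne k hk.2]
  rw [hL, hL', hR, hR', hrest, haTℓ, haTne s hℓs.symm, ha₀s]
  push_cast
  ring

omit [Fintype κ] [DecidableEq κ] in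
/-- Prefix products of gates in `[0,1]` are antitone in the length. [folklore] -/
theorem prefixProd_antitone (q : ℕ → ℝ) (hq : ∀ i, 0 ≤ q i ∧ q i ≤ 1) {m n : ℕ} (hmn : m ≤ n) :
    ∏ i ∈ Finset.range n, q i ≤ ∏ i ∈ Finset.range m, q i := by
  rw [← Finset.prod_range_mul_prod_Ico q hmn]
  have h1 : ∏ i ∈ Finset.Ico m n, q i ≤ 1 := Finset.prod_le_one (fun i _ => (hq i).1) fun i _ => (hq i).2
  have h0 : 0 ≤ ∏ i ∈ Finset.range m, q i := Finset.prod_nonneg fun i _ => (hq i).1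
  calc (∏ i ∈ Finset.range m, q i) * ∏ i ∈ Finset.Ico m n, q i ≤ (∏ i ∈ Finset.range m, q i) * 1 :=
      mul_le_mul_of_nonneg_left h1 h0
    _ = ∏ i ∈ Finset.range m, q i := mul_one _

omit [DecidableEq κ] in
/-- The `D = 1` mean `Σ_{lv k = 0} a k·g k + q 0·Σ_{lv k ≠ 0} a k` as one weighted size sum. [folklore] -/
theorem meanOne_eq_sum (q : ℕ → ℝ) (lv : κ → ℕ) (a : κ → ℕ) (g : κ → ℝ) :
    ∑ k ∈ Finset.univ.filter (fun k => lv k = 0), (a k : ℝ) * g k +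
      q 0 * ∑ k ∈ Finset.univ.filter (fun k => lv k ≠ 0), (a k : ℝ) =
        ∑ k, (a k : ℝ) * (if lv k = 0 then g k else q 0) := by
  rw [Finset.sum_filter, Finset.sum_filter, Finset.mul_sum, ← Finset.sum_add_distrib]
  refine Finset.sum_congr rfl fun k _ => ?_
  by_cases hk : lv k = 0
  · rw [if_pos hk, if_neg (not_not.2 hk), if_pos hk]; ring
  · rw [if_neg hk, if_pos hk, if_neg hk]; ring

/-! ### 2. The light-merge row, `D = 1` -/

/-- The induction behind `tail_one_ge_rootGate_of_lightMerge` (on the number of light blobs, live or dead): reset the gate of a dead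
light blob / merge the least reliable live light blob / no light blob: the block-star row under the mean hypothesis. [this work] -/
theorem tail_one_ge_rootGate_of_lightMerge_aux : ∀ (n : ℕ) (q : ℕ → ℝ), (∀ i, 0 ≤ q i ∧ q i ≤ 1) →
    ∀ (lv : κ → ℕ), (∀ k, lv k ≤ 1) → ∀ (a : κ → ℕ) (g : κ → ℝ), (∀ k, 0 ≤ g k ∧ g k ≤ 1) →
    (∀ k, lv k ≠ 0 → g k = 1) → ∀ (j : ℕ), 0 < j →
    (2 * j : ℝ) < ∑ k ∈ Finset.univ.filter (fun k => lv k = 0), (a k : ℝ) * g k +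
      q 0 * ∑ k ∈ Finset.univ.filter (fun k => lv k ≠ 0), (a k : ℝ) →
    (∀ s, 0 < a s → g s < q 0 → (j : ℝ) ≤ g s * ∑ k ∈ Finset.univ.filter (fun k => q 0 ≤ g k), (a k : ℝ)) →
    (Finset.univ.filter (fun k => g k < q 0)).card ≤ n →
    q 0 ≤ TAIL[1, q, lv, a, g, j] := by
  intro n
  induction n with
  | zero =>
    intro q hq lv hlv a g hg hsure j hj hmean hlight hn
    have hnone : ∀ k, q 0 ≤ g k := by
      intro k
      by_contra h
      have hmem : k ∈ Finset.univ.filter (fun k => g k < q 0) :=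
        Finset.mem_filter.2 ⟨Finset.mem_univ _, lt_of_not_ge h⟩
      have := Finset.card_pos.2 ⟨k, hmem⟩
      omega
    exact tail_one_ge_rootGate_of_mean q (hq 0) lv hlv a g hg (fun k _ => hnone k) hsure j hmean
  | succ n ih =>
    intro q hq lv hlv a g hg hsure j hj hmean hlight hn
    -- STEP A: resetting the gate of a DEAD light blob keeps every hypothesis and removes one light blob
    have kill : ∀ (a : κ → ℕ), (2 * j : ℝ) < ∑ k ∈ Finset.univ.filter (fun k => lv k = 0), (a k : ℝ) * g k +
          q 0 * ∑ k ∈ Finset.univ.filter (fun k => lv k ≠ 0), (a k : ℝ) →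
        (∀ s, 0 < a s → g s < q 0 → (j : ℝ) ≤ g s * ∑ k ∈ Finset.univ.filter (fun k => q 0 ≤ g k), (a k : ℝ)) →
        ∀ s, a s = 0 → g s < q 0 → q 0 ≤ TAIL[1, q, lv, a, g, j] := by
      intro a hmean hlight s hs hslt
      set g' := Function.update g s 1 with hg'
      have hg's : g' s = 1 := by rw [hg', Function.update_self]
      have hg'ne : ∀ k, k ≠ s → g' k = g k := fun k hk => by rw [hg', Function.update_of_ne hk]
      have hg'01 : ∀ k, 0 ≤ g' k ∧ g' k ≤ 1 := by
        intro k
        by_cases hk : k = s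
        · rw [hk, hg's]; norm_num
        · rw [hg'ne k hk]; exact hg k
      have hsure' : ∀ k, lv k ≠ 0 → g' k = 1 := by
        intro k hk
        by_cases hks : k = s
        · rw [hks, hg's]
        · rw [hg'ne k hks]; exact hsure k hk
      -- the mean is unchanged (the term of `s` vanishes either way)
      have hmean' : (2 * j : ℝ) < ∑ k ∈ Finset.univ.filter (fun k => lv k = 0), (a k : ℝ) * g' k +
          q 0 * ∑ k ∈ Finset.univ.filter (fun k => lv k ≠ 0), (a k : ℝ) := by
        have heq : ∑ k ∈ Finset.univ.filter (fun k => lv k = 0), (a k : ℝ) * g' k =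
            ∑ k ∈ Finset.univ.filter (fun k => lv k = 0), (a k : ℝ) * g k := by
          refine Finset.sum_congr rfl fun k _ => ?_
          by_cases hks : k = s
          · rw [hks, hs]; simp
          · rw [hg'ne k hks]
        rw [heq]; exact hmean
      -- the reliable mass can only grow
      have hrel : ∑ k ∈ Finset.univ.filter (fun k => q 0 ≤ g k), (a k : ℝ) ≤
          ∑ k ∈ Finset.univ.filter (fun k => q 0 ≤ g' k), (a k : ℝ) := by
        refine Finset.sum_le_sum_of_subset_of_nonneg ?_ (fun k _ _ => Nat.cast_nonneg _)
        intro k hk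
        have hk' := (Finset.mem_filter.1 hk).2
        refine Finset.mem_filter.2 ⟨Finset.mem_univ _, ?_⟩
        by_cases hks : k = s
        · rw [hks, hg's]; exact (hq 0).2
        · rw [hg'ne k hks]; exact hk'
      have hlight' : ∀ s', 0 < a s' → g' s' < q 0 →
          (j : ℝ) ≤ g' s' * ∑ k ∈ Finset.univ.filter (fun k => q 0 ≤ g' k), (a k : ℝ) := by
        intro s' hs' hlt
        have hs's : s' ≠ s := fun h => by rw [h, hs] at hs'; exact lt_irrefl _ hs'
        rw [hg'ne s' hs's] at hlt ⊢
        exact (hlight s' hs' hlt).trans (mul_le_mul_of_nonneg_left hrel (hg s').1)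
      -- one light blob fewer
      have hcard : (Finset.univ.filter (fun k => g' k < q 0)).card ≤ n := by
        have hsub : Finset.univ.filter (fun k => g' k < q 0) ⊆ (Finset.univ.filter (fun k => g k < q 0)).erase s := by
          intro k hk
          have hk' := (Finset.mem_filter.1 hk).2
          have hks : k ≠ s := fun h => by
            rw [h, hg's] at hk'
            exact absurd hk' (not_lt.2 (hq 0).2)
          rw [hg'ne k hks] at hk'
          exact Finset.mem_erase.2 ⟨hks, Finset.mem_filter.2 ⟨Finset.mem_univ _, hk'⟩⟩
        have hsmem : s ∈ Finset.univ.filter (fun k => g k < q 0) := Finset.mem_filter.2 ⟨Finset.mem_univ _, hslt⟩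
        have h1 := Finset.card_le_card hsub
        rw [Finset.card_erase_of_mem hsmem] at h1
        have hpos : 0 < (Finset.univ.filter (fun k => g k < q 0)).card := Finset.card_pos.2 ⟨s, hsmem⟩
        omega
      rw [← tail_update_dead 1 q lv a g j s 1 hs]
      exact ih q hq lv hlv a g' hg'01 hsure' j hj hmean' hlight' hcard
    -- STEP B: the case split
    by_cases hdead : ∃ s, a s = 0 ∧ g s < q 0
    · obtain ⟨s, hs, hslt⟩ := hdead
      exact kill a hmean hlight s hs hslt
    push Not at hdead
    by_cases hnolight : ∀ k, q 0 ≤ g k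
    · exact tail_one_ge_rootGate_of_mean q (hq 0) lv hlv a g hg (fun k _ => hnolight k) hsure j hmean
    push Not at hnolight
    -- the least reliable light blob `s` (it is live, by `hdead`)
    have hLne : (Finset.univ.filter (fun k => g k < q 0)).Nonempty := by
      obtain ⟨k, hk⟩ := hnolight
      exact ⟨k, Finset.mem_filter.2 ⟨Finset.mem_univ _, hk⟩⟩
    obtain ⟨s, hsL, hsmin⟩ := Finset.exists_min_image (Finset.univ.filter (fun k => g k < q 0)) g hLne
    have hslt : g s < q 0 := (Finset.mem_filter.1 hsL).2
    have hs : 0 < a s := Nat.pos_of_ne_zero fun h => absurd hslt (not_lt.2 (hdead s h))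
    have hs0 : lv s = 0 := by
      by_contra h
      have h1 := hsure s h
      rw [h1] at hslt
      exact absurd hslt (not_lt.2 (hq 0).2)
    -- every blob is at least as reliable as `s`
    have hge : ∀ k, g s ≤ g k := by
      intro k
      by_cases hk : g k < q 0
      · exact hsmin k (Finset.mem_filter.2 ⟨Finset.mem_univ _, hk⟩)
      · push Not at hk; exact hslt.le.trans hk
    set a₀ := Function.update a s 0 with ha₀
    have ha₀s : a₀ s = 0 := by rw [ha₀, Function.update_self]
    have ha₀ne : ∀ k, k ≠ s → a₀ k = a k := fun k hk => by rw [ha₀, Function.update_of_ne hk]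
    -- the merge hypothesis `j ≤ g s·Σ_{k ≠ s} a k` (the reliable mass avoids `s`)
    have hM : (j : ℝ) ≤ g s * ∑ k, ((a₀ k : ℕ) : ℝ) := by
      refine (hlight s hs hslt).trans (mul_le_mul_of_nonneg_left ?_ (hg s).1)
      rw [← Finset.sum_filter_add_sum_filter_not Finset.univ (fun k => q 0 ≤ g k) (fun k => ((a₀ k : ℕ) : ℝ))]
      have heq : ∑ k ∈ Finset.univ.filter (fun k => q 0 ≤ g k), ((a₀ k : ℕ) : ℝ) =
          ∑ k ∈ Finset.univ.filter (fun k => q 0 ≤ g k), (a k : ℝ) := by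
        refine Finset.sum_congr rfl fun k hk => ?_
        have hks : k ≠ s := fun h => by
          have h2 := (Finset.mem_filter.1 hk).2
          rw [h] at h2
          exact absurd hslt (not_lt.2 h2)
        rw [ha₀ne k hks]
      rw [heq]
      have hnn : 0 ≤ ∑ k ∈ Finset.univ.filter (fun k => ¬ q 0 ≤ g k), ((a₀ k : ℕ) : ℝ) :=
        Finset.sum_nonneg fun k _ => Nat.cast_nonneg _
      linarith
    -- another live blob exists: the reliable mass is positive since `j ≥ 1`
    have hpos : ∃ k, 0 < a₀ k := by
      by_contra hnone
      push Not at hnone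
      have hzero : ∑ k, ((a₀ k : ℕ) : ℝ) = 0 :=
        Finset.sum_eq_zero fun k _ => by rw [Nat.le_zero.1 (hnone k)]; simp
      rw [hzero, mul_zero] at hM
      have : (0 : ℝ) < j := by exact_mod_cast hj
      linarith
    obtain ⟨ℓ, hℓ, hle⟩ := tail_transfer_le 1 q hq lv a g hg j s hs0 hM hpos
    have hℓs : ℓ ≠ s := by
      intro h; rw [h, Function.update_self] at hℓ; exact lt_irrefl _ hℓ
    set aT := Function.update a₀ ℓ (a₀ ℓ + a s) with haT
    have haTs : aT s = 0 := by rw [haT, Function.update_of_ne hℓs.symm, ha₀s]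
    have haTℓ : aT ℓ = a ℓ + a s := by rw [haT, Function.update_self, ha₀ne ℓ hℓs]
    have haTne : ∀ k, k ≠ s → k ≠ ℓ → aT k = a k := fun k hks hkℓ => by
      rw [haT, Function.update_of_ne hkℓ, ha₀ne k hks]
    -- live blobs after the transfer were live before, and `s` is not among them
    have hlive : ∀ k, 0 < aT k → 0 < a k ∧ k ≠ s := by
      intro k hk
      have hks : k ≠ s := fun h => by rw [h, haTs] at hk; exact lt_irrefl _ hk
      refine ⟨?_, hks⟩
      by_cases hkℓ : k = ℓ
      · rw [hkℓ, ← ha₀ne ℓ hℓs]; exact hℓ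
      · rw [← haTne k hks hkℓ]; exact hk
    -- sizes off `s` do not decrease
    have hmonoT : ∀ k, k ≠ s → a k ≤ aT k := by
      intro k hks
      by_cases hkℓ : k = ℓ
      · rw [hkℓ, haTℓ]; exact Nat.le_add_right _ _
      · rw [haTne k hks hkℓ]
    -- the mean does not decrease: the transfer trades `a s·g s` for `a s·g ℓ` (`ℓ` at the root) or `a s·q 0` (`ℓ` sure)
    have hmeanT : (2 * j : ℝ) < ∑ k ∈ Finset.univ.filter (fun k => lv k = 0), (aT k : ℝ) * g k +
        q 0 * ∑ k ∈ Finset.univ.filter (fun k => lv k ≠ 0), (aT k : ℝ) := by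
      rw [meanOne_eq_sum] at hmean ⊢
      rw [haT, ha₀, sum_cast_transfer_mul a s ℓ hℓs]
      have hgain : 0 ≤ (a s : ℝ) * ((if lv ℓ = 0 then g ℓ else q 0) - (if lv s = 0 then g s else q 0)) := by
        refine mul_nonneg (Nat.cast_nonneg _) (sub_nonneg.2 ?_)
        rw [if_pos hs0]
        split_ifs
        · exact hge ℓ
        · exact hslt.le
      linarith
    -- the merge hypothesis persists: gates unchanged, reliable mass not smaller
    have hlightT : ∀ s', 0 < aT s' → g s' < q 0 →
        (j : ℝ) ≤ g s' * ∑ k ∈ Finset.univ.filter (fun k => q 0 ≤ g k), (aT k : ℝ) := by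
      intro s' hs' hlt
      refine (hlight s' (hlive s' hs').1 hlt).trans (mul_le_mul_of_nonneg_left ?_ (hg s').1)
      refine Finset.sum_le_sum fun k hk => ?_
      have hks : k ≠ s := fun h => by
        have h2 := (Finset.mem_filter.1 hk).2
        rw [h] at h2
        exact absurd hslt (not_lt.2 h2)
      exact_mod_cast hmonoT k hks
    -- conclude: the tail did not increase, and `s` is now a dead light blob
    exact (kill aT hmeanT hlightT s haTs hslt).trans hle

/-- **THEOREM (the light-merge row, `D = 1`, canonical model).**  One chain gate `q 0 ∈ [0,1]`, levels `≤ 1`, root blobs with ARBITRARY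
private gates in `[0,1]`, level-`1` blobs sure, a layer `j ≥ 1`, the mean hypothesis `2j < Σ_{lv k = 0} a k·g k + q 0·Σ_{lv k ≠ 0} a k`,
and the merge hypothesis: every live LIGHT root blob `s` (`g s < q 0`) satisfies `j ≤ g s·Σ_{g k ≥ q 0} a k` (it can see `j` reliable
relays).  Then `q 0 ≤ TAIL[1, q, lv, a, g, j] = P(N ≥ j+1)`.  `tail_one_ge_rootGate_of_mean` is the case without light blobs. [this work] -/
theorem tail_one_ge_rootGate_of_lightMerge (q : ℕ → ℝ) (hq : ∀ i, 0 ≤ q i ∧ q i ≤ 1) (lv : κ → ℕ) (hlv : ∀ k, lv k ≤ 1)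
    (a : κ → ℕ) (g : κ → ℝ) (hg : ∀ k, 0 ≤ g k ∧ g k ≤ 1) (hsure : ∀ k, lv k ≠ 0 → g k = 1) (j : ℕ) (hj : 0 < j)
    (hmean : (2 * j : ℝ) < ∑ k ∈ Finset.univ.filter (fun k => lv k = 0), (a k : ℝ) * g k +
      q 0 * ∑ k ∈ Finset.univ.filter (fun k => lv k ≠ 0), (a k : ℝ))
    (hlight : ∀ s, 0 < a s → g s < q 0 → (j : ℝ) ≤ g s * ∑ k ∈ Finset.univ.filter (fun k => q 0 ≤ g k), (a k : ℝ)) :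
    q 0 ≤ TAIL[1, q, lv, a, g, j] :=
  tail_one_ge_rootGate_of_lightMerge_aux _ q hq lv hlv a g hg hsure j hj hmean hlight le_rfl

end BlockComb

end Quant

end Summit.CriticalPhenomena.PercolationContinuityZ3.Theorems
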